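import Summits.Ventures.QEDPrecision.Certificates.DeltaM4Target

/-!
# ΔM₄_b = −3/16 — typed record of the exact evaluation of int-1's fourth-order
self-energy-insertion amplitude (venture QEDPrecision, cell `pub-qed`, integrand seat int-1, gen 12)

HONEST FRAMING (verbatim, venture QEDPrecision): independent recomputation; certified where stated,
statistical where stated; no new-physics claim.

In the Aoyama–Hayakawa–Kinoshita–Nio (AHKN) subtraction scheme the finite fourth-order amplitude
splits over the two no-lepton-loop self-energy-like diagrams, `ΔM₄ = ΔM₄ₐ(abab) + ΔM₄_b(abba)`;
print gives only VEGAS values for the two parts (PRD 77, 053012 (2008) §VI.A: `0.218 78(35)`,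
`−0.187 73(40)`). The cell observed `ΔM₄_b = −3/16` to `2·10⁻¹²` (int-1 VALIDATION §V3; conjectured
by referee ref-2, round 6) and int-1 gen 12 then DERIVED it: the exact rational Feynman-parametric
integrand of `ΔM₄_b` produced by int-1's generator (bare term, K-forest term of the self-energy
subdiagram, IR term) depends on the outer lepton parameters only through their sum `s`, so in the
Cheng–Wu gauge `s + z₂ = 1` the two photon parameters integrate out in closed form (logarithms only,
no dilogarithm), leaving the one-variable function `F2` below, whose integral over `(0,1)` is `−3/16`
(memo `pub-qed-int-1/DM4B-CLOSED-FORM.md`, scripts `code/int1/tools/dm4b_exact/`, every layer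
cross-validated numerically). STATUS (venture lead D203): DERIVED, not certified (one implementation
of layers 0–2), not an R-row, no number of record changes. What is KERNEL-CHECKED here: (i) the
algebraic skeleton of the last layer — the partial-fraction decompositions of the three rational
coefficients of `F2`, the regrouping of `F2` into a regular part and two endpoint-singular parts
(`F2_regroup`), the exact cancellation of the endpoint poles (`sing_sum`), the final arithmetic;
(ii) the last layer itself as measure theory, CONDITIONALLY: `deltaM4b_eq_of_hypotheses` proves
`ΔM₄_b = −3/16` from two NAMED HYPOTHESES (explicit `def … : Prop`, used only as hypotheses — never
axioms, never Literature facts): `Layers012Hypothesis` = layers 0–2 of the memo ("the simplex integral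
of int-1's `ΔM₄_b` integrand equals `∫₀¹ F2`, `F2` interval-integrable"; exact computer algebra, not
Lean) and `TableIntegrals` = the two classical values `∫₀¹ (log(1−u)/u² + 1/u) du = −1`,
`∫₀¹ (log(1−u)/u³ + 1/u² + 1/(2u)) du = −3/4` with the integrability of their integrands (elementary,
stated not proved); the third table input `∫₀¹ (log(1−s) − log s) ds = 0` IS proved
(`integral_log_reflect_sub`); (iii) the consequence `ΔM₄ₐ = c2qClosedForm + 9/16 =
−11/8 + 5π²/12 − (π²/2) log 2 + (3/4) ζ(3)` enclosed to `10⁻¹⁸`. int-1's deterministic cubature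
values stay data; `int1_de_value_consistent` only records that the datum `0.218 333 612 562 734`
lies within `1.1·10⁻¹²` of the exact target.
-/

namespace Summit.Ventures.QEDPrecision.Integrands

open Real
open Literature.MathematicalPhysics.QuantumFieldTheory.LaportaRemiddi1996 (zeta)
open Summit.Ventures.QEDPrecision.Certificates (c2qClosedForm deltaM4ClosedForm
  deltaM4ClosedForm_enclosure)

/-! ## The layer-2 function `F2(s)` (int-1 memo DM4B-CLOSED-FORM §2, L2) -/

/-- Coefficient of `log (1 − s)` in `F2`. [cell result: int-1 gen 12] -/
noncomputable def F2om (s : ℝ) : ℝ := (12 * s ^ 3 + 7 * s + 1) / (24 * s ^ 3)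

/-- Coefficient of `log s` in `F2`. [cell result: int-1 gen 12] -/
noncomputable def F2s (s : ℝ) : ℝ := (12 * s ^ 3 - 36 * s ^ 2 + 13 * s - 8) / (24 * (1 - s) ^ 3)

/-- Rational part of `F2`. [cell result: int-1 gen 12] -/
noncomputable def F2rat (s : ℝ) : ℝ :=
  (24 * s ^ 4 - 60 * s ^ 3 - 15 * s ^ 2 + 11 * s + 2) / (48 * s ^ 2 * (1 - s) ^ 2)

/-- `F2(s)`: the exact result of integrating int-1's `ΔM₄_b` integrand over both photon Feynman
parameters in the Cheng–Wu gauge `s + z₂ = 1` (`s` = sum of the two outer lepton parameters);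
`ΔM₄_b = ∫₀¹ F2`. [cell result: int-1 gen 12] -/
noncomputable def F2 (s : ℝ) : ℝ := F2rat s + F2s s * log s + F2om s * log (1 - s)

/-- Partial fractions of the `log (1 − s)` coefficient: no simple pole at `s = 0`
(so no `ζ(2)` can arise from it). -/
theorem F2om_pf (s : ℝ) (hs : s ≠ 0) :
    F2om s = 1 / 2 + 7 / (24 * s ^ 2) + 1 / (24 * s ^ 3) := by
  unfold F2om
  field_simp
  ring

/-- Partial fractions of the `log s` coefficient: no simple pole at `s = 1`
(so no `ζ(2)` can arise from it). -/
theorem F2s_pf (s : ℝ) (hs : s ≠ 1) :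
    F2s s = -1 / 2 + 23 / (24 * (1 - s) ^ 2) - 19 / (24 * (1 - s) ^ 3) := by
  have h1 : (1 - s) ≠ 0 := sub_ne_zero.mpr (Ne.symm hs)
  unfold F2s
  field_simp
  ring

/-- Partial fractions of the rational part. -/
theorem F2rat_pf (s : ℝ) (hs : s ≠ 0) (hs1 : s ≠ 1) :
    F2rat s = 1 / 2 + 5 / (16 * s) + 1 / (24 * s ^ 2) + 9 / (16 * (1 - s)) - 19 / (24 * (1 - s) ^ 2) := by
  have h1 : (1 - s) ≠ 0 := sub_ne_zero.mpr (Ne.symm hs1)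
  unfold F2rat
  field_simp
  ring

/-! ## Regrouping into a regular part and the two endpoint-singular parts -/

/-- The pieces of `F2` singular at `s = 0`, as a function of `u = s`. -/
noncomputable def sing0 (u : ℝ) : ℝ :=
  (7 / (24 * u ^ 2) + 1 / (24 * u ^ 3)) * log (1 - u) + 5 / (16 * u) + 1 / (24 * u ^ 2)

/-- The pieces of `F2` singular at `s = 1`, as a function of `u = 1 − s`
(note `log s = log (1 − u)`). -/
noncomputable def sing1 (u : ℝ) : ℝ :=
  (23 / (24 * u ^ 2) - 19 / (24 * u ^ 3)) * log (1 - u) + 9 / (16 * u) - 19 / (24 * u ^ 2)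

/-- `F2 = ½(1 + log(1−s) − log s) + sing0(s) + sing1(1−s)` on `(0,1)` (indeed for `s ≠ 0, 1`). -/
theorem F2_regroup (s : ℝ) (hs : s ≠ 0) (hs1 : s ≠ 1) :
    F2 s = 1 / 2 * (1 + log (1 - s) - log s) + sing0 s + sing1 (1 - s) := by
  have h1 : (1 - s) ≠ 0 := sub_ne_zero.mpr (Ne.symm hs1)
  have hl : log (1 - (1 - s)) = log s := by rw [sub_sub_cancel]
  unfold F2 sing0 sing1
  rw [hl, F2om_pf s hs, F2s_pf s hs1, F2rat_pf s hs hs1]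
  ring

/-- The regularised weight-one integrand `log(1−u)/u² + 1/u` (`= −Σ_{m≥0} u^m/(m+2)`). -/
noncomputable def reg2 (u : ℝ) : ℝ := log (1 - u) / u ^ 2 + 1 / u

/-- The regularised integrand `log(1−u)/u³ + 1/u² + 1/(2u)` (`= −Σ_{m≥0} u^m/(m+3)`). -/
noncomputable def reg3 (u : ℝ) : ℝ := log (1 - u) / u ^ 3 + 1 / u ^ 2 + 1 / (2 * u)

/-- **Exact cancellation of the endpoint poles**: after mapping the `s = 1` pieces to `u = 1 − s`,
the two singular groups combine into the two regularised integrands with coefficients `5/4` and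
`−3/4`; the `1/u` poles cancel as `5/16 + 9/16 − 5/4 + 3/8 = 0` and the `1/u²` poles as
`1/24 − 19/24 + 3/4 = 0`. -/
theorem sing_sum (u : ℝ) (hu : u ≠ 0) :
    sing0 u + sing1 u = 5 / 4 * reg2 u - 3 / 4 * reg3 u := by
  unfold sing0 sing1 reg2 reg3
  field_simp
  ring

/-! ## The last layer's arithmetic -/

/-- The final arithmetic of the derivation (memo §2, L3): regular part `½·(1 + 0)` (using
`∫₀¹ (log(1−s) − log s) = 0`), plus `5/4·(−1)`, minus `3/4·(−3/4)`, equals `−3/16`. -/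
theorem last_layer_arith : (1 : ℝ) / 2 * (1 + 0) + 5 / 4 * (-1) - 3 / 4 * (-3 / 4) = -3 / 16 := by
  norm_num

/-! ## Consequence for the other diagram: `ΔM₄ₐ(abab) = c2qClosedForm + 9/16` -/

/-- The exact value of `ΔM₄_b(abba)` (int-1's AHKN-scheme finite amplitude of the
self-energy-insertion diagram). [cell result: int-1 gen 12] -/
noncomputable def deltaM4bClosedForm : ℝ := -3 / 16

/-- The exact value of `ΔM₄ₐ(abab) = ΔM₄ − ΔM₄_b`. [cell result: int-1 gen 12] -/
noncomputable def deltaM4aClosedForm : ℝ := deltaM4ClosedForm - deltaM4bClosedForm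

/-- `ΔM₄ₐ = c2qClosedForm + 9/16`. -/
theorem deltaM4aClosedForm_eq_c2q : deltaM4aClosedForm = c2qClosedForm + 9 / 16 := by
  unfold deltaM4aClosedForm deltaM4bClosedForm deltaM4ClosedForm
  ring

/-- `ΔM₄ₐ = −11/8 + 5π²/12 − (π²/2) log 2 + (3/4) ζ(3)`. -/
theorem deltaM4aClosedForm_eq :
    deltaM4aClosedForm = -11 / 8 + 5 * π ^ 2 / 12 - π ^ 2 / 2 * log 2 + 3 / 4 * zeta 3 := by
  rw [deltaM4aClosedForm_eq_c2q]
  unfold c2qClosedForm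
  ring

/-- **ΔM₄ₐ target enclosure (kernel-checked)**: `|ΔM₄ₐ − 0.218333612561703533| ≤ 10⁻¹⁸`,
from `deltaM4ClosedForm_enclosure`. -/
theorem deltaM4aClosedForm_enclosure :
    Encloses deltaM4aClosedForm (218333612561703533 / 10 ^ 18) (1 / 10 ^ 18) := by
  have h := deltaM4ClosedForm_enclosure
  unfold Encloses at h ⊢
  unfold deltaM4aClosedForm deltaM4bClosedForm
  rw [abs_le] at h ⊢
  push_cast at h ⊢
  obtain ⟨h1, h2⟩ := h
  constructor
  · linarith
  · linarith

/-- int-1's deterministic double-exponential cubature of `ΔM₄ₐ(abab)` (job j077160, uniform DE,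
`m = 256`, long double; VALIDATION §V3: `0.218 333 612 562 734`) lies within `1.1·10⁻¹²` of the
exact target — a consistency record; the datum is not a theorem about the integral. -/
theorem int1_de_value_consistent :
    |deltaM4aClosedForm - 218333612562734 / 10 ^ 15| ≤ 11 / 10 ^ 13 := by
  have h := deltaM4aClosedForm_enclosure
  unfold Encloses at h
  rw [abs_le] at h ⊢
  push_cast at h ⊢
  obtain ⟨h1, h2⟩ := h
  constructor
  · linarith
  · linarith

/-! ## Named hypotheses (explicit, never axioms) and the conditional value
(venture lead D203: "derived, not certified; layers 0–2 hypothesis") -/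

open MeasureTheory intervalIntegral Set
open scoped Interval

/-- **HYPOTHESIS (layers 0–2)** — derived by exact computer algebra (int-1 gen 12, memo
DM4B-CLOSED-FORM.md §2 L0–L2; every layer cross-validated numerically), NOT kernel-checked, NOT
certified: the AHKN-scheme finite amplitude `ΔM₄_b(abba)` — the five-simplex integral of int-1's exact
rational integrand — equals `∫₀¹ F2`, with `F2` interval-integrable on `[0,1]`. Typed as a predicate
on the candidate value; it is used only as an explicit hypothesis of `deltaM4b_eq_of_hypotheses`. -/
def Layers012Hypothesis (ΔM4b : ℝ) : Prop :=
  IntervalIntegrable F2 volume 0 1 ∧ ΔM4b = ∫ s in (0:ℝ)..1, F2 s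

/-- **HYPOTHESIS (table integrals)** — the two classical values used by the last layer (memo §2 L3),
`∫₀¹ (log(1−u)/u² + 1/u) du = −1` (antiderivative `−(1−u) log(1−u)/u`) and
`∫₀¹ (log(1−u)/u³ + 1/u² + 1/(2u)) du = −3/4`, together with the interval-integrability of the two
regularised integrands. Elementary, but stated rather than proved here. [folklore] -/
def TableIntegrals : Prop :=
  IntervalIntegrable reg2 volume 0 1 ∧ (∫ u in (0:ℝ)..1, reg2 u) = -1 ∧
    IntervalIntegrable reg3 volume 0 1 ∧ (∫ u in (0:ℝ)..1, reg3 u) = -3 / 4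

/-- `∫₀¹ (log(1−s) − log s) ds = 0` (reflection `s ↦ 1 − s`; proved). -/
theorem integral_log_reflect_sub : (∫ s in (0:ℝ)..1, (log (1 - s) - log s)) = 0 := by
  have h1 : (∫ s in (0:ℝ)..1, log (1 - s)) = ∫ s in (0:ℝ)..1, log s := by
    have := intervalIntegral.integral_comp_sub_left (fun s => log s) (1:ℝ) (a := 0) (b := 1)
    simp only [sub_self, sub_zero] at this
    exact this
  have hl : IntervalIntegrable (fun s => log s) volume 0 1 := intervalIntegral.intervalIntegrable_log'
  have hl1 : IntervalIntegrable (fun s => log (1 - s)) volume 0 1 := by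
    have := (intervalIntegral.intervalIntegrable_log' (a := (1:ℝ)) (b := 0)).comp_sub_left 1
    simp only [sub_self, sub_zero] at this
    exact this
  rw [intervalIntegral.integral_sub hl1 hl, h1, sub_self]

/-- Off the single point `s = 1`, almost every `s` satisfies `s ≠ 1`. -/
private theorem ae_ne_one : ∀ᵐ s ∂(volume : Measure ℝ), s ≠ (1:ℝ) := by
  have h : (({(1:ℝ)} : Set ℝ)ᶜ) ∈ ae (volume : Measure ℝ) := compl_mem_ae_iff.2 Real.volume_singleton
  filter_upwards [h] with s hs
  simpa using hs

/-- **Conditional value (kernel-checked glue)**: under the two named hypotheses, `ΔM₄_b = −3/16`.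
The proof is the memo's last layer done in measure theory: regroup `F2` a.e. on `(0,1]`
(`F2_regroup`), integrate the regular part (`integral_log_reflect_sub`), symmetrise the singular part
under `s ↦ 1 − s` so that only the integrable combination `sing0 + sing1 = 5/4·reg2 − 3/4·reg3`
(`sing_sum`) is ever split, and finish with the arithmetic of `last_layer_arith`. -/
theorem deltaM4b_eq_of_hypotheses (x : ℝ) (h012 : Layers012Hypothesis x) (hT : TableIntegrals) :
    x = deltaM4bClosedForm := by
  obtain ⟨hF2i, hx⟩ := h012
  obtain ⟨hreg2i, hreg2, hreg3i, hreg3⟩ := hT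
  have h01 : (0:ℝ) ≤ 1 := zero_le_one
  -- membership in the integration domain `Ι 0 1 = Ioc 0 1`
  have hmem : ∀ s : ℝ, s ∈ Ι (0:ℝ) 1 → 0 < s ∧ s ≤ 1 := by
    intro s hs
    rw [Set.uIoc_of_le h01] at hs
    exact hs
  -- integrability of the logarithms and of the regular part
  have hl : IntervalIntegrable (fun s : ℝ => log s) volume 0 1 :=
    intervalIntegral.intervalIntegrable_log'
  have hl1 : IntervalIntegrable (fun s : ℝ => log (1 - s)) volume 0 1 := by
    have := (intervalIntegral.intervalIntegrable_log' (a := (1:ℝ)) (b := 0)).comp_sub_left 1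
    simp only [sub_self, sub_zero] at this
    exact this
  have hAi : IntervalIntegrable (fun s : ℝ => 1 / 2 * (1 + log (1 - s) - log s)) volume 0 1 :=
    ((intervalIntegrable_const.add hl1).sub hl).const_mul (1 / 2)
  -- the regular part integrates to 1/2
  have hA : (∫ s in (0:ℝ)..1, 1 / 2 * (1 + log (1 - s) - log s)) = 1 / 2 * (1 + 0) := by
    rw [intervalIntegral.integral_const_mul]
    congr 1
    have e : (fun s : ℝ => 1 + log (1 - s) - log s) = fun s => (1:ℝ) + (log (1 - s) - log s) := by
      funext s; ring
    rw [e, intervalIntegral.integral_add intervalIntegrable_const (hl1.sub hl),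
      integral_log_reflect_sub, intervalIntegral.integral_const]
    simp
  -- a.e. regrouping of F2 on the domain (the point s = 1 is null)
  have hF2ae : ∀ᵐ s ∂(volume : Measure ℝ), s ∈ Ι (0:ℝ) 1 →
      F2 s = 1 / 2 * (1 + log (1 - s) - log s) + (sing0 s + sing1 (1 - s)) := by
    filter_upwards [ae_ne_one] with s hs1 hs
    have hs0 : s ≠ 0 := ne_of_gt (hmem s hs).1
    rw [F2_regroup s hs0 hs1]
    ring
  have hF2int : (∫ s in (0:ℝ)..1, F2 s) =
      ∫ s in (0:ℝ)..1, (1 / 2 * (1 + log (1 - s) - log s) + (sing0 s + sing1 (1 - s))) :=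
    intervalIntegral.integral_congr_ae hF2ae
  -- integrability of the singular part B(s) = sing0 s + sing1 (1 - s), inherited from F2
  have hABi : IntervalIntegrable
      (fun s : ℝ => 1 / 2 * (1 + log (1 - s) - log s) + (sing0 s + sing1 (1 - s))) volume 0 1 := by
    rw [intervalIntegrable_iff_integrableOn_Ioc_of_le h01] at hF2i ⊢
    refine hF2i.congr_fun_ae ?_
    rw [Filter.EventuallyEq, ae_restrict_iff' measurableSet_Ioc]
    filter_upwards [hF2ae] with s hs hsm
    exact hs (by rwa [Set.uIoc_of_le h01])
  have hBi : IntervalIntegrable (fun s : ℝ => sing0 s + sing1 (1 - s)) volume 0 1 := by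
    have h := hABi.sub hAi
    refine (intervalIntegrable_iff_integrableOn_Ioc_of_le h01).2
      (((intervalIntegrable_iff_integrableOn_Ioc_of_le h01).1 h).congr_fun_ae ?_)
    exact Filter.Eventually.of_forall (fun s => by ring)
  -- split F2 = A + B under the integral
  have hsplit : (∫ s in (0:ℝ)..1, (1 / 2 * (1 + log (1 - s) - log s) + (sing0 s + sing1 (1 - s)))) =
      (∫ s in (0:ℝ)..1, 1 / 2 * (1 + log (1 - s) - log s)) +
        ∫ s in (0:ℝ)..1, (sing0 s + sing1 (1 - s)) :=
    intervalIntegral.integral_add hAi hBi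
  -- symmetrisation of B under s ↦ 1 - s
  have hBσ : (∫ s in (0:ℝ)..1, (sing0 (1 - s) + sing1 s)) =
      ∫ s in (0:ℝ)..1, (sing0 s + sing1 (1 - s)) := by
    have := intervalIntegral.integral_comp_sub_left (fun s => sing0 s + sing1 (1 - s)) (1:ℝ)
      (a := 0) (b := 1)
    simp only [sub_self, sub_zero, sub_sub_cancel] at this
    exact this
  have hBσi : IntervalIntegrable (fun s : ℝ => sing0 (1 - s) + sing1 s) volume 0 1 := by
    have := (hBi.comp_sub_left 1).symm
    simp only [sub_self, sub_zero, sub_sub_cancel] at this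
    exact this
  have h2B : 2 * (∫ s in (0:ℝ)..1, (sing0 s + sing1 (1 - s))) =
      ∫ s in (0:ℝ)..1, ((sing0 s + sing1 (1 - s)) + (sing0 (1 - s) + sing1 s)) := by
    rw [intervalIntegral.integral_add hBi hBσi, hBσ]
    ring
  -- a.e. on the domain, B + B∘σ = R + R∘σ with R = 5/4 reg2 - 3/4 reg3 (pole cancellation)
  have hRae : ∀ᵐ s ∂(volume : Measure ℝ), s ∈ Ι (0:ℝ) 1 →
      (sing0 s + sing1 (1 - s)) + (sing0 (1 - s) + sing1 s) =
        (5 / 4 * reg2 s - 3 / 4 * reg3 s) + (5 / 4 * reg2 (1 - s) - 3 / 4 * reg3 (1 - s)) := by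
    filter_upwards [ae_ne_one] with s hs1 hs
    have hs0 : s ≠ 0 := ne_of_gt (hmem s hs).1
    have hs1' : (1:ℝ) - s ≠ 0 := sub_ne_zero.mpr (Ne.symm hs1)
    have e1 := sing_sum s hs0
    have e2 := sing_sum (1 - s) hs1'
    linarith
  have hRint : (∫ s in (0:ℝ)..1, ((sing0 s + sing1 (1 - s)) + (sing0 (1 - s) + sing1 s))) =
      ∫ s in (0:ℝ)..1, ((5 / 4 * reg2 s - 3 / 4 * reg3 s) +
        (5 / 4 * reg2 (1 - s) - 3 / 4 * reg3 (1 - s))) :=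
    intervalIntegral.integral_congr_ae hRae
  -- integrate R and R∘σ with the table integrals
  have hRi : IntervalIntegrable (fun s : ℝ => 5 / 4 * reg2 s - 3 / 4 * reg3 s) volume 0 1 :=
    (hreg2i.const_mul (5 / 4)).sub (hreg3i.const_mul (3 / 4))
  have hRσi : IntervalIntegrable (fun s : ℝ => 5 / 4 * reg2 (1 - s) - 3 / 4 * reg3 (1 - s))
      volume 0 1 := by
    have := (hRi.comp_sub_left 1).symm
    simp only [sub_self, sub_zero] at this
    exact this
  have hR : (∫ s in (0:ℝ)..1, (5 / 4 * reg2 s - 3 / 4 * reg3 s)) = 5 / 4 * (-1) - 3 / 4 * (-3 / 4) := by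
    rw [intervalIntegral.integral_sub (hreg2i.const_mul (5 / 4)) (hreg3i.const_mul (3 / 4)),
      intervalIntegral.integral_const_mul, intervalIntegral.integral_const_mul, hreg2, hreg3]
  have hRσ : (∫ s in (0:ℝ)..1, (5 / 4 * reg2 (1 - s) - 3 / 4 * reg3 (1 - s))) =
      ∫ s in (0:ℝ)..1, (5 / 4 * reg2 s - 3 / 4 * reg3 s) := by
    have := intervalIntegral.integral_comp_sub_left (fun s => 5 / 4 * reg2 s - 3 / 4 * reg3 s) (1:ℝ)
      (a := 0) (b := 1)
    simp only [sub_self, sub_zero] at this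
    exact this
  have hRsum : (∫ s in (0:ℝ)..1, ((5 / 4 * reg2 s - 3 / 4 * reg3 s) +
      (5 / 4 * reg2 (1 - s) - 3 / 4 * reg3 (1 - s)))) = 2 * (5 / 4 * (-1) - 3 / 4 * (-3 / 4)) := by
    rw [intervalIntegral.integral_add hRi hRσi, hRσ, hR]
    ring
  -- assemble
  have hB : (∫ s in (0:ℝ)..1, (sing0 s + sing1 (1 - s))) = 5 / 4 * (-1) - 3 / 4 * (-3 / 4) := by
    have := h2B
    rw [hRint, hRsum] at this
    linarith
  unfold deltaM4bClosedForm
  rw [hx, hF2int, hsplit, hA, hB]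
  norm_num

end Summit.Ventures.QEDPrecision.Integrands
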